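import Literature.NumberTheory.EllipticCurves.Kato2004.UniversalNormsCoeffTools
import Literature.NumberTheory.EllipticCurves.GreenbergSelmerCofreeReductionPkProofs
import Literature.NumberTheory.EllipticCurves.GreenbergSelmerCofreeTorsionGaloisModule
import Literature.NumberTheory.EllipticCurves.GreenbergSelmerCharIdealPrincipalProofs
import Literature.NumberTheory.GaloisRepresentations.PadicAlgClFiniteSubextensionDvr
import Mathlib.NumberTheory.Padics.ProperSpace
import Mathlib.Analysis.Normed.Module.FiniteDimension
import HarnessLib

/-!
# Kato 2004 (Astérisque 295) Lemma 8.5 (2) for the lattice `T_ρ = 𝒪ⁿ` of a framed Galois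
# representation with coefficients `𝒪 = padicCoeffIntegers S` (integers of a finite `ℚ_p(S)/ℚ_p`):
# cores-compatible families along the cyclotomic `ℤ_p`-tower are integral at every `v ≠ p`

Topic `NumberTheory/EllipticCurves`, sub-directory `Kato2004` (namespace = path, sub-namespace
`UniversalNorms`).  THEOREMS ONLY (no definition, no named fact, no instance, no `sorry`).  Sequel of
`UniversalNormsCoeffTools` (same seat, cell `bsd-wall`, crux RSL_g stmt-BirchSwinnertonDyer-22608,
card `stub-cmlambdalower-k3-g9` PLAN 1 = stub-plan rev 12 item UN_ρ): the `ρ`-COEFFICIENT twin of the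
K6 theorem `UniversalNorms.mem_integralH1_of_layerCores_eq` (there `T = T_pW`).  For a framed
representation `ρ : Γ_ℚ → GL_n(𝒪)`, `𝒪 = padicCoeffIntegers S ⊂ ℚ̄_p` the valuation ring of
`ℚ_p(S)` with `[FiniteDimensional ℚ_[p] (padicCoeffField S)]`, lattice `T_ρ = 𝒪ⁿ`
(`FramedGaloisRep.toGaloisRep ρ`) and discrete quotient `A_ρ = ℚ_p(S)ⁿ/𝒪ⁿ` (`GreenbergSelmer.Cofree`):

* §1 `isCompact_padicCoeffIntegers`, `compactSpace_padicCoeffIntegers` — `𝒪` is COMPACT (the closed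
  unit ball of the finite-dimensional `ℚ_p`-space `ℚ_p(S)`, `ℚ_p` locally compact: Mathlib
  `FiniteDimensional.proper`); `tendsto_pow_smul_pi_padicCoeffIntegers` — `p^m • y_m → 0` in `𝒪ⁿ` for
  every sequence (`‖p^m y‖ ≤ ‖p‖^m`).
* §2 `finite_cofreeTorsionBy_of_compactSpace` — `A_ρ[p^k]` is finite (continuous image
  `divPowCofreeMkTorsion` of the compact `𝒪ⁿ` in a discrete space); `natCard_cofreeTorsionBy_eq_pow` —
  its order is a power of `p`.
* §3 `exists_pow_smul_eq_of_reduceH1CofreePkTorsion_eq_zero`, `reduceH1CofreePkTorsion_eq_zero_iff` —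
  **Kato §13.8 levelwise for `T_ρ`: `ker (red_{p^k} : H¹(U, T_ρ) → H¹(U, A_ρ[p^k])) = p^k · H¹(U, T_ρ)`**
  (cocycle argument of `Kato2004.exists_smul_eq_of_reduceH1_eq_zero`, with `T/p^kT ≅ A[p^k]`:
  `divPowCofreeMk_eq_zero_iff`, `divPowCofreeMkTorsion_surjective`).
* §4 `exists_finset_forall_sub_eq_pow_smul_framed` — `H¹(U ⊓ I_𝔓, T_ρ)/p^m` has finitely many residues
  (`I_𝔓 ≤ U`, `𝔓 ∣ v ≠ p`): reduction modulo `p^m` has kernel `p^m H¹` (§3) and finite target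
  (`UniversalNorms.finite_subgroupH1_inf_inertia_of_finite` with §2).
* §5 **`mem_integralH1_of_layerCores_eq_framed` — Kato's Lemma 8.5 (2) for `T_ρ`**: for the cyclotomic
  `ℤ_p`-extension `κ` and every family `z_n ∈ H¹(ℚ_n, T_ρ)` with `Cor z_{n+1} = z_n`, every `z_n` lies in
  `H¹(ℤ_n[1/p], T_ρ) = Kato2004.integralH1` (unramified at every `v ≠ p`).  Printed: "The image of
  `lim←_n H¹(K(ζ_{p^n}), T) → H¹(K, T)` is contained in the image of `H¹(O_K[1/p], T) → H¹(K, T)`"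
  [Kato, Lemma 8.5 (2), p. 183; Rubin B.3.3; Perrin-Riou 2.2.4] — for ANY finitely generated `ℤ_p`-`T`;
  here `T = T_ρ`.  Proof = the K6 assembly (inert layers `exists_generator`, inert step
  `exists_resLe_coresLe_eq_pow_smul_of_generator_coeff` modulo every `p^m`, `⋂_m p^m H¹ = 0` by
  `eq_zero_of_forall_exists_pow_smul_eq_of_compactSpace`, class-level transport
  `resLe_coresLe_eq_zero_of_forall_primesAbove`), no Frobenius weights, slack `1`.

HONEST FRAMING: a port; Kato's lemma is a published theorem; nothing here is specific to BSD or to the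
crux RSL_g (whose Poitou–Tate port consumes it as the integrality of limit classes, `UN_ρ`); BSD is not
proved by any of this.

References: K. Kato, Astérisque 295 (2004), §8.2, Lemma 8.5 (pp. 180–184), §13.8 (pp. 228–229)
[Kato2004Asterisque]; K. Rubin, *Euler Systems* (2000), App. B Prop. B.2.3, B.3.3 [Rubin2000];
R. Greenberg, Adv. Stud. Pure Math. 17 (1989), §1 p. 98 [Greenberg1989]; J. Neukirch, *Algebraic Number
Theory* (1999), Ch. II (4.8), (5.?) compactness of valuation rings [NeukirchANT1999]; J.-P. Serre,
*Local Fields* (1979), II §1 Prop. 1 [SerreLocalFields1979].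
-/

noncomputable section

open scoped NumberField Pointwise
open CategoryTheory Field IsDedekindDomain Filter Topology
open Literature.NumberTheory.GaloisRepresentations
open Literature.NumberTheory.EllipticCurves
open Literature.NumberTheory.EllipticCurves.GreenbergSelmer
open Literature.NumberTheory.EllipticCurves.ZpExtension
open Literature.NumberTheory.EllipticCurves.Kato2004
open Literature.NumberTheory.EllipticCurves.Kato2004.EulerSystemValues
open Rat.HeightOneSpectrum

namespace Literature.NumberTheory.EllipticCurves.Kato2004.UniversalNorms

variable {p : ℕ} [Fact p.Prime] (S : Set (PadicAlgCl p))

/-! ## §1 `𝒪 = padicCoeffIntegers S` is compact; `p^m y_m → 0` in `𝒪ⁿ` -/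

section Compact

/-- **The valuation ring `𝒪` of a finite extension `ℚ_p(S)` of `ℚ_p` is compact** (as a subset of
`ℚ̄_p`): it is the image of the closed unit ball of the finite-dimensional normed `ℚ_p`-space `ℚ_p(S)`,
which is proper since `ℚ_p` is locally compact (Mathlib `FiniteDimensional.proper`).
[cite: SerreLocalFields1979, II §1 Prop. 1] [cite: NeukirchANT1999, Ch. II (5.1)] -/
theorem isCompact_padicCoeffIntegers [FiniteDimensional ℚ_[p] (padicCoeffField S)] :
    IsCompact (padicCoeffIntegers S : Set (PadicAlgCl p)) := by
  letI : NormedSpace ℚ_[p] (padicCoeffField S) :=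
    { norm_smul_le := fun r x => by
        rw [PadicAlgCl.norm_coe, PadicAlgCl.norm_coe]
        change ‖((r • x : padicCoeffField S) : PadicAlgCl p)‖ ≤ ‖r‖ * ‖(x : PadicAlgCl p)‖
        rw [IntermediateField.coe_smul, norm_smul] }
  haveI : ProperSpace (padicCoeffField S) := FiniteDimensional.proper ℚ_[p] (padicCoeffField S)
  have hc : IsCompact (Metric.closedBall (0 : padicCoeffField S) 1) := isCompact_closedBall 0 1
  have himg : ((↑) : padicCoeffField S → PadicAlgCl p) '' Metric.closedBall (0 : padicCoeffField S) 1 =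
      (padicCoeffIntegers S : Set (PadicAlgCl p)) := by
    ext x
    simp only [Set.mem_image, Metric.mem_closedBall, dist_zero_right, SetLike.mem_coe,
      mem_padicCoeffIntegers_iff]
    constructor
    · rintro ⟨y, hy, rfl⟩
      exact ⟨y.2, by rwa [PadicAlgCl.norm_coe] at hy⟩
    · rintro ⟨hxS, hx⟩
      exact ⟨⟨x, hxS⟩, by rw [PadicAlgCl.norm_coe]; exact hx, rfl⟩
  rw [← himg]
  exact hc.image continuous_subtype_val

/-- `𝒪 = padicCoeffIntegers S` is a compact space (`isCompact_padicCoeffIntegers`).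
[cite: SerreLocalFields1979, II §1 Prop. 1] -/
theorem compactSpace_padicCoeffIntegers [FiniteDimensional ℚ_[p] (padicCoeffField S)] :
    CompactSpace (padicCoeffIntegers S) :=
  isCompact_iff_compactSpace.mp (isCompact_padicCoeffIntegers S)

/-- **`p^m • y_m → 0` in `𝒪ⁿ`** for every sequence `(y_m)` (`‖p^m y‖ ≤ ‖p‖^m` coordinatewise, `‖p‖ < 1`
in `ℚ̄_p`). [cite: SerreLocalFields1979, II §1] -/
theorem tendsto_pow_smul_pi_padicCoeffIntegers {n : ℕ} (y : ℕ → (Fin n → padicCoeffIntegers S)) :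
    Tendsto (fun m => ((p : padicCoeffIntegers S) ^ m) • y m) atTop (𝓝 0) := by
  rw [tendsto_pi_nhds]
  intro i
  rw [Topology.IsInducing.subtypeVal.tendsto_nhds_iff]
  change Tendsto (fun m => ((((p : padicCoeffIntegers S) ^ m * y m i : padicCoeffIntegers S)) : PadicAlgCl p))
    atTop (𝓝 0)
  have hp1 : ‖(p : PadicAlgCl p)‖ < 1 := by
    have hp : (p : ℕ).Prime := Fact.out
    rw [← map_natCast (algebraMap ℚ_[p] (PadicAlgCl p)), PadicAlgCl.norm_extends, Padic.norm_p]
    exact inv_lt_one_of_one_lt₀ (by exact_mod_cast hp.one_lt)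
  have h0 : Tendsto (fun m : ℕ => ‖(p : PadicAlgCl p)‖ ^ m) atTop (𝓝 0) :=
    tendsto_pow_atTop_nhds_zero_of_lt_one (norm_nonneg _) hp1
  refine squeeze_zero_norm (fun m => ?_) h0
  rw [Subring.coe_mul, Subring.coe_pow, Subring.coe_natCast, norm_mul, norm_pow]
  exact mul_le_of_le_one_right (pow_nonneg (norm_nonneg _) _) (y m i).2.2

end Compact

/-! ## §2 `A_ρ[p^k]` is finite of `p`-power order -/

section TorsionFinite

variable {n : ℕ} (ρ : FramedGaloisRep ℚ (padicCoeffIntegers S) n) (k : ℕ)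

/-- **`A_ρ[p^k]` is finite** when `𝒪` is compact: it is the image of the compact `𝒪ⁿ` under the
continuous map `divPowCofreeMkTorsion` (`t ↦ p^{-k}t mod 𝒪ⁿ`, onto `A_ρ[p^k]`:
`divPowCofreeMkTorsion_surjective`) into a discrete space. [cite: Greenberg1989, §1 p. 98] -/
theorem finite_cofreeTorsionBy_of_compactSpace [CompactSpace (padicCoeffIntegers S)] :
    Finite ↥(AddSubgroup.torsionBy (Cofree ρ (padicCoeffField S)) ((p ^ k : ℕ) : ℤ)) := by
  have hc : IsCompact (Set.range (divPowCofreeMkTorsion S ρ k)) :=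
    isCompact_range (continuous_divPowCofreeMkTorsion S ρ k)
  rw [(divPowCofreeMkTorsion_surjective S ρ k).range_eq] at hc
  exact Set.finite_univ_iff.mp hc.finite_of_discrete

/-- The order of the finite group `A_ρ[p^k]` is a power of `p` (it is killed by `p^k`).
[cite: Greenberg1989, §1 p. 98] -/
theorem natCard_cofreeTorsionBy_eq_pow [CompactSpace (padicCoeffIntegers S)] :
    ∃ r : ℕ, Nat.card ↥(AddSubgroup.torsionBy (Cofree ρ (padicCoeffField S)) ((p ^ k : ℕ) : ℤ)) = p ^ r := by
  haveI := finite_cofreeTorsionBy_of_compactSpace S ρ k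
  haveI : Fact p.Prime := inferInstance
  have hP : IsPGroup p (Multiplicative ↥(AddSubgroup.torsionBy (Cofree ρ (padicCoeffField S)) ((p ^ k : ℕ) : ℤ))) := by
    intro g
    refine ⟨k, ?_⟩
    have hg : (p ^ k) • (Multiplicative.toAdd g) = 0 := by
      have h := (Submodule.mem_torsionBy_iff (R := ℤ) _ _).mp (Multiplicative.toAdd g).2
      rw [natCast_zsmul] at h
      apply Subtype.ext
      rw [AddSubmonoidClass.coe_nsmul, ZeroMemClass.coe_zero]
      exact h
    rw [← ofAdd_toAdd g, ← ofAdd_nsmul, hg, ofAdd_zero]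
  obtain ⟨r, hr⟩ := (IsPGroup.iff_card).mp hP
  exact ⟨r, by rw [← hr]; rfl⟩

end TorsionFinite

/-! ## §3 The kernel of `red_{p^k} : H¹(U, T_ρ) → H¹(U, A_ρ[p^k])` is `p^k · H¹(U, T_ρ)` -/

section Kernel

variable {n : ℕ} (ρ : FramedGaloisRep ℚ (padicCoeffIntegers S) n) (k : ℕ)

/-- Division by `p^k` on `𝒪`: if every coordinate of `t ∈ 𝒪ⁿ` lies in `p^k𝒪`, then `t = p^k • s` for a
(unique) `s ∈ 𝒪ⁿ`, namely `s_i = p^{-k} t_i` (private helper; `•` is the `ℕ`-action). [folklore] -/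
private theorem exists_eq_pow_nsmul_of_forall_mem_span (t : Fin n → padicCoeffIntegers S)
    (ht : ∀ i, t i ∈ Ideal.span {((p : padicCoeffIntegers S)) ^ k}) :
    ∃ s : Fin n → padicCoeffIntegers S, p ^ k • s = t := by
  choose s hs using fun i => Ideal.mem_span_singleton'.mp (ht i)
  refine ⟨s, funext fun i => ?_⟩
  rw [Pi.smul_apply, ← Nat.cast_smul_eq_nsmul (padicCoeffIntegers S), smul_eq_mul, Nat.cast_pow, mul_comm,
    hs i]

/-- `p^k` is a non-zero-divisor on `𝒪ⁿ` (`𝒪 ⊂ ℚ̄_p` is a domain of characteristic `0`): `p^k • a = p^k • b`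
implies `a = b` (private helper; `•` is the `ℕ`-action). [folklore] -/
private theorem eq_of_pow_nsmul_eq {a b : Fin n → padicCoeffIntegers S} (h : p ^ k • a = p ^ k • b) :
    a = b := by
  have hpk : ((p : padicCoeffIntegers S)) ^ k ≠ 0 := by
    refine pow_ne_zero _ fun h0 => ?_
    have h' := congrArg (fun x : padicCoeffIntegers S => (x : PadicAlgCl p)) h0
    simp only [Subring.coe_natCast, ZeroMemClass.coe_zero, Nat.cast_eq_zero] at h'
    exact (Fact.out : p.Prime).ne_zero h'
  funext i
  have hi := congr_fun h i
  rw [Pi.smul_apply, Pi.smul_apply, ← Nat.cast_smul_eq_nsmul (padicCoeffIntegers S),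
    ← Nat.cast_smul_eq_nsmul (padicCoeffIntegers S) (p ^ k) (b i), smul_eq_mul, smul_eq_mul,
    Nat.cast_pow] at hi
  exact mul_left_cancel₀ hpk hi

set_option maxHeartbeats 400000 in
/-- **Levelwise Kato §13.8 for `T_ρ`: `ker red_{p^k} ⊆ p^k · H¹`.**  For every subgroup `U ≤ Γ_ℚ` and
every `x ∈ H¹(U, T_ρ)` whose reduction `red_{p^k} x ∈ H¹(U, A_ρ[p^k])` (`reduceH1CofreePkTorsion`)
vanishes, `x = p^k • z` for some `z ∈ H¹(U, T_ρ)` — exactness of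
`H¹(U, T_ρ) →p^k H¹(U, T_ρ) → H¹(U, T_ρ/p^k)` with `T_ρ/p^k ≅ A_ρ[p^k]`.  PROOF on cocycles (the tree's
`Kato2004.exists_smul_eq_of_reduceH1_eq_zero` for `T_pW`, verbatim): `red [φ] = [div_k ∘ φ] = 0` gives
`a ∈ A_ρ[p^k]` with `div_k (φ g) = g a − a`; lift `a = div_k m` (`divPowCofreeMkTorsion_surjective`);
`c'(g) := φ(g) − (g m − m)` has `div_k (c' g) = 0`, so `c'(g) ∈ p^k 𝒪ⁿ` (`divPowCofreeMk_eq_zero_iff`),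
`c' = p^k d` with `d` continuous and a crossed homomorphism (`p^k` is a non-zero-divisor); `[φ] = p^k [d]`.
[cite: Kato2004Asterisque, §13.8 (pp. 228–229)] [cite: Greenberg1989, §1 p. 98] -/
theorem exists_pow_smul_eq_of_reduceH1CofreePkTorsion_eq_zero (U : Subgroup (absoluteGaloisGroup ℚ))
    (x : H1 (FramedGaloisRep.toGaloisRep ρ) U) (hx : reduceH1CofreePkTorsion S ρ k U x = 0) :
    ∃ z : H1 (FramedGaloisRep.toGaloisRep ρ) U, ((p : padicCoeffIntegers S) ^ k) • z = x := by
  classical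
  obtain ⟨φ, rfl⟩ := oneCocycleClass_surjective _ x
  rw [reduceH1CofreePkTorsion_oneCocycleClass, oneCocycleClass_eq_zero_iff] at hx
  obtain ⟨a, ha⟩ := hx
  -- lift `a` to `m ∈ 𝒪ⁿ`
  obtain ⟨m, hm⟩ := divPowCofreeMkTorsion_surjective S ρ k a
  -- the values of `φ` reduce to the coboundary of `a`
  have ha' : ∀ g : U, divPowCofreeMkTorsion S ρ k (φ.1 g) =
      (discreteTopRep U ↥(AddSubgroup.torsionBy (Cofree ρ (padicCoeffField S)) ((p ^ k : ℕ) : ℤ))).ρ g a - a :=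
    fun g => by
      have h := ha g
      rw [contOneCocycles.pushAddHom_apply] at h
      exact h
  -- the corrected values `c' g = φ g − (g m − m)` reduce to `0`
  let c' : U → (Fin n → padicCoeffIntegers S) := fun g => φ.1 g - ((subgroupRep (FramedGaloisRep.toGaloisRep ρ).toTopRep U).ρ g m - m)
  have hc'cont : Continuous c' :=
    φ.1.continuous.sub ((((FramedGaloisRep.toGaloisRep ρ).continuous_apply_left m).comp
      continuous_subtype_val).sub continuous_const)
  have hc'0 : ∀ g, divPowCofreeMkTorsion S ρ k (c' g) = 0 := fun g => by
    change divPowCofreeMkTorsion S ρ k (φ.1 g - ((subgroupRep (FramedGaloisRep.toGaloisRep ρ).toTopRep U).ρ g m - m)) = 0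
    rw [map_sub, map_sub, divPowCofreeMkTorsion_subgroupRep, hm, ha', sub_self]
  have hc'mul : ∀ g h : U, c' (g * h) = c' g + (subgroupRep (FramedGaloisRep.toGaloisRep ρ).toTopRep U).ρ g (c' h) := fun g h => by
    have hgh : (subgroupRep (FramedGaloisRep.toGaloisRep ρ).toTopRep U).ρ (g * h) m = (subgroupRep (FramedGaloisRep.toGaloisRep ρ).toTopRep U).ρ g ((subgroupRep (FramedGaloisRep.toGaloisRep ρ).toTopRep U).ρ h m) := by rw [map_mul]; rfl
    simp only [c', φ.2 g h, hgh, map_sub]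
    abel
  -- `d g := c' g / p^k`
  have hdiv : ∀ g, ∃ s : Fin n → padicCoeffIntegers S, p ^ k • s = c' g := fun g => by
    refine exists_eq_pow_nsmul_of_forall_mem_span S k (c' g) ?_
    have h0 : divPowCofreeMk S ρ k (c' g) = 0 := by
      have := congrArg (fun b : ↥(AddSubgroup.torsionBy (Cofree ρ (padicCoeffField S)) ((p ^ k : ℕ) : ℤ)) =>
        (b : Cofree ρ (padicCoeffField S))) (hc'0 g)
      simpa only [coe_divPowCofreeMkTorsion_apply, ZeroMemClass.coe_zero] using this
    exact (divPowCofreeMk_eq_zero_iff S ρ k (c' g)).mp h0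
  choose d₀ hd₀ using hdiv
  -- continuity of `d₀`: coordinatewise `(d₀ g i : ℚ̄_p) = p^{-k} (c' g i : ℚ̄_p)`
  have hpk : ((p : PadicAlgCl p)) ^ k ≠ 0 :=
    pow_ne_zero _ (Nat.cast_ne_zero.mpr (Fact.out : p.Prime).ne_zero)
  have hcoord : ∀ g i, ((d₀ g i : padicCoeffIntegers S) : PadicAlgCl p) =
      (((p : PadicAlgCl p)) ^ k)⁻¹ * ((c' g i : padicCoeffIntegers S) : PadicAlgCl p) := fun g i => by
    have h := congr_fun (hd₀ g) i
    rw [Pi.smul_apply] at h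
    have h' := congrArg (fun x : padicCoeffIntegers S => (x : PadicAlgCl p)) h
    simp only [nsmul_eq_mul, Nat.cast_pow, Subring.coe_mul, Subring.coe_pow, Subring.coe_natCast] at h'
    rw [← h', ← mul_assoc, inv_mul_cancel₀ hpk, one_mul]
  have hd₀cont : Continuous d₀ := by
    refine continuous_pi fun i => ?_
    rw [Topology.IsInducing.subtypeVal.continuous_iff]
    refine ((continuous_const (y := (((p : PadicAlgCl p)) ^ k)⁻¹)).mul
      (continuous_subtype_val.comp ((continuous_apply i).comp hc'cont))).congr fun g => ?_
    exact (hcoord g i).symm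
  -- `d` is a crossed homomorphism: `p^k •` of the defect vanishes and `p^k` is a non-zero-divisor
  have hdmul : ∀ g h : U, d₀ (g * h) = d₀ g + (subgroupRep (FramedGaloisRep.toGaloisRep ρ).toTopRep U).ρ g (d₀ h) := fun g h => by
    refine eq_of_pow_nsmul_eq S k ?_
    rw [hd₀, nsmul_add, hd₀, ← map_nsmul, hd₀, hc'mul]
  let d : contOneCocycles (subgroupRep (FramedGaloisRep.toGaloisRep ρ).toTopRep U) := ⟨⟨d₀, hd₀cont⟩, hdmul⟩
  refine ⟨oneCocycleClass _ d, ?_⟩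
  -- `[φ] = p^k • [d]`: `φ − p^k • d = ∂m` (scalar `(p : 𝒪)^k = ((p^k : ℕ) : 𝒪)`, then the `ℕ`-action)
  have e : ((p : padicCoeffIntegers S)) ^ k = ((p ^ k : ℕ) : padicCoeffIntegers S) := (Nat.cast_pow p k).symm
  rw [e, ← oneCocycleClass_smul, eq_comm, ← sub_eq_zero, ← oneCocycleClass_sub, oneCocycleClass_eq_zero_iff]
  refine ⟨m, fun g => ?_⟩
  have hd₀' : ((p ^ k : ℕ) : padicCoeffIntegers S) • d₀ g = c' g := by
    rw [Nat.cast_smul_eq_nsmul]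
    exact hd₀ g
  -- `(φ - p^k • d)(g) = φ g − c' g = g m − m` (term-mode: the values live in the carrier of `T_ρ|_U`)
  exact (congrArg (fun y => φ.1 g - y) hd₀').trans (sub_sub_cancel _ _)

/-- `H¹` of a module killed by `N` is killed by `N`: `N • c = 0` for `c ∈ H¹(U, B)`, `B ≤ A[N]` (private
helper, on cocycles). [folklore] -/
private theorem natCast_smul_subgroupH1_torsionBy_eq_zero (N : ℕ) (U : Subgroup (absoluteGaloisGroup ℚ))
    (c : subgroupH1 U ↥(AddSubgroup.torsionBy (Cofree ρ (padicCoeffField S)) ((N : ℕ) : ℤ))) :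
    N • c = 0 := by
  obtain ⟨ψ, rfl⟩ := oneCocycleClass_surjective _ c
  have h := oneCocycleClass_smul (discreteTopRep U ↥(AddSubgroup.torsionBy (Cofree ρ (padicCoeffField S)) ((N : ℕ) : ℤ)))
    ((N : ℕ) : ℤ) ψ
  conv at h => rhs; rw [Nat.cast_smul_eq_nsmul]
  rw [← h]
  have h0 : ((N : ℕ) : ℤ) • ψ = 0 := by
    apply Subtype.ext
    ext u
    change ((N : ℕ) : ℤ) • ((ψ.1 u : ↥(AddSubgroup.torsionBy (Cofree ρ (padicCoeffField S)) ((N : ℕ) : ℤ))) :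
      Cofree ρ (padicCoeffField S)) = 0
    exact (Submodule.mem_torsionBy_iff (R := ℤ) _ _).mp (ψ.1 u).2
  rw [h0, oneCocycleClass_zero]

/-- **`ker (red_{p^k} : H¹(U, T_ρ) → H¹(U, A_ρ[p^k])) = p^k · H¹(U, T_ρ)`** (Kato §13.8 at the level `U`
for `T_ρ`): `red x = 0 ↔ ∃ z, p^k • z = x` (`exists_pow_smul_eq_of_reduceH1CofreePkTorsion_eq_zero`; the
converse because `H¹(U, A_ρ[p^k])` is killed by `p^k`). [cite: Kato2004Asterisque, §13.8 (pp. 228–229)] -/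
theorem reduceH1CofreePkTorsion_eq_zero_iff (U : Subgroup (absoluteGaloisGroup ℚ))
    (x : H1 (FramedGaloisRep.toGaloisRep ρ) U) :
    reduceH1CofreePkTorsion S ρ k U x = 0 ↔
      ∃ z : H1 (FramedGaloisRep.toGaloisRep ρ) U, ((p : padicCoeffIntegers S) ^ k) • z = x := by
  refine ⟨exists_pow_smul_eq_of_reduceH1CofreePkTorsion_eq_zero S ρ k U x, ?_⟩
  rintro ⟨z, rfl⟩
  rw [← Nat.cast_pow, Nat.cast_smul_eq_nsmul, map_nsmul]
  exact natCast_smul_subgroupH1_torsionBy_eq_zero S ρ (p ^ k) U _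

end Kernel

/-! ## §4 `H¹(U ⊓ I_𝔓, T_ρ)/p^m` has finitely many residues -/

section Residues

variable {n : ℕ} (ρ : FramedGaloisRep ℚ (padicCoeffIntegers S) n)

/-- **`N/p^m N` is finite**, `N = H¹(U ⊓ I_𝔓, T_ρ)`, `I_𝔓 ≤ U`, `𝔓 ∣ v ≠ p`, `𝒪` compact: there is a
finite set `S₀ ⊆ N` with every `x ∈ N` congruent to some `s ∈ S₀` modulo `p^m N` — the reduction
`red_{p^m} : N → H¹(U ⊓ I_𝔓, A_ρ[p^m])` has finite target (`finite_subgroupH1_inf_inertia_of_finite` with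
`finite_cofreeTorsionBy_of_compactSpace`, `natCard_cofreeTorsionBy_eq_pow`) and kernel `p^m N`
(`reduceH1CofreePkTorsion_eq_zero_iff`).  Twin of the K6 `exists_finset_forall_sub_eq_pow_smul`.
[cite: Kato2004Asterisque, Lemma 8.5 (2) (p. 184), proof] [cite: MilneADT2006, I §2 Lemma 2.9] -/
theorem exists_finset_forall_sub_eq_pow_smul_framed [CompactSpace (padicCoeffIntegers S)]
    {v : HeightOneSpectrum (𝓞 ℚ)} (hv : (p : 𝓞 ℚ) ∉ v.asIdeal) {𝔓 : Ideal (absIntegers (𝓞 ℚ) ℚ)}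
    (h𝔓 : 𝔓 ∈ v.primesAbove) {U : Subgroup (absoluteGaloisGroup ℚ)}
    (hIU : 𝔓.inertia (absoluteGaloisGroup ℚ) ≤ U) (m : ℕ) :
    ∃ S₀ : Finset (H1 (FramedGaloisRep.toGaloisRep ρ) (U ⊓ 𝔓.inertia (absoluteGaloisGroup ℚ))),
      ∀ x, ∃ s ∈ S₀, ∃ y : H1 (FramedGaloisRep.toGaloisRep ρ) (U ⊓ 𝔓.inertia (absoluteGaloisGroup ℚ)),
        x - s = ((p : padicCoeffIntegers S) ^ m) • y := by
  classical
  haveI := finite_cofreeTorsionBy_of_compactSpace S ρ m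
  obtain ⟨r, hr⟩ := natCard_cofreeTorsionBy_eq_pow S ρ m
  haveI : Finite (subgroupH1 (U ⊓ 𝔓.inertia (absoluteGaloisGroup ℚ))
      ↥(AddSubgroup.torsionBy (Cofree ρ (padicCoeffField S)) ((p ^ m : ℕ) : ℤ))) :=
    finite_subgroupH1_inf_inertia_of_finite (cofreeTorsionGaloisModule S ρ ((p ^ m : ℕ) : ℤ))
      (cofreeTorsionGaloisModule_apply_apply S ρ _) p hr hv h𝔓 hIU
  haveI := Fintype.ofFinite (subgroupH1 (U ⊓ 𝔓.inertia (absoluteGaloisGroup ℚ))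
      ↥(AddSubgroup.torsionBy (Cofree ρ (padicCoeffField S)) ((p ^ m : ℕ) : ℤ)))
  set red := reduceH1CofreePkTorsion S ρ m (U ⊓ 𝔓.inertia (absoluteGaloisGroup ℚ))
  -- a section of `red` over its (finite) range
  let sec : subgroupH1 (U ⊓ 𝔓.inertia (absoluteGaloisGroup ℚ))
        ↥(AddSubgroup.torsionBy (Cofree ρ (padicCoeffField S)) ((p ^ m : ℕ) : ℤ)) →
      H1 (FramedGaloisRep.toGaloisRep ρ) (U ⊓ 𝔓.inertia (absoluteGaloisGroup ℚ)) :=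
    fun r => if h : ∃ x, red x = r then h.choose else 0
  refine ⟨Finset.univ.image sec, fun x => ⟨sec (red x), Finset.mem_image_of_mem _ (Finset.mem_univ _),
    ?_⟩⟩
  have hex : ∃ x', red x' = red x := ⟨x, rfl⟩
  have hsec : red (sec (red x)) = red x := by
    simp only [sec, dif_pos hex]
    exact hex.choose_spec
  have h0 : red (x - sec (red x)) = 0 := by rw [map_sub, hsec, sub_self]
  obtain ⟨z, hz⟩ := (reduceH1CofreePkTorsion_eq_zero_iff S ρ m _ _).mp h0
  exact ⟨z, hz.symm⟩

end Residues

/-! ## §5 Kato's Lemma 8.5 (2) for `T_ρ` -/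

section Assembly

variable {n : ℕ} (ρ : FramedGaloisRep ℚ (padicCoeffIntegers S) n)

/-- **Kato 2004, Lemma 8.5 (2), for the lattice `T_ρ = 𝒪ⁿ` of a framed representation
`ρ : Gal(ℚ̄/ℚ) → GL_n(𝒪)`, `𝒪` COMPACT** (e.g. the valuation ring of a finite extension of `ℚ_p`,
`compactSpace_padicCoeffIntegers`).  Let `κ` be the cyclotomic `ℤ_p`-extension with layers
`ℚ_m = ℚ̄^{Γ_m}` and `z = (z_m)_m`, `z_m ∈ H¹(ℚ_m, T_ρ)`, a CORES-COMPATIBLE family (`Cor z_{m+1} = z_m`).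
Then every `z_m` is integral (unramified at every `v ≠ p`: `Kato2004.integralH1`).  Printed: "The image
of `lim←_n H¹(K(ζ_{p^n}), T) → H¹(K, T)` is contained in the image of `H¹(O_K[1/p], T) → H¹(K, T)`"
[Kato, Lemma 8.5 (2), p. 183; = Rubin, *Euler Systems*, B.3.3; Perrin-Riou 2.2.4] — the `ρ`-coefficient
twin of the K6 theorem `UniversalNorms.mem_integralH1_of_layerCores_eq` (`T = T_pW`), same proof:
inert layers `n' ≥ n₀` (`exists_generator`), inert step modulo every `p^m`
(`exists_resLe_coresLe_eq_pow_smul_of_generator_coeff`, residues by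
`exists_finset_forall_sub_eq_pow_smul_framed`), `⋂_m p^m H¹(Γ_{n'} ∩ I_𝔓', T_ρ) = 0`
(`eq_zero_of_forall_exists_pow_smul_eq_of_compactSpace`, `tendsto_pow_smul_pi_padicCoeffIntegers`),
class-level transport along `cor_{Γ_{n'} → Γ_m}` (`resLe_coresLe_eq_zero_of_forall_primesAbove`).
Slack `1`, no purity / Frobenius-weight input. [cite: Kato2004Asterisque, Lemma 8.5 (2) (p. 183)]
[cite: Rubin2000, App. B Prop. B.3.3] -/
theorem mem_integralH1_of_layerCores_eq_framed [CompactSpace (padicCoeffIntegers S)]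
    (κ : ZpExtension ℚ p) (hκ : κ.IsCyclotomic)
    (z : ∀ m : ℕ, H1 (FramedGaloisRep.toGaloisRep ρ) (κ.layerSubgroup m))
    (hz : ∀ m, layerCores (FramedGaloisRep.toGaloisRep ρ) κ m (z (m + 1)) = z m) (m₀ : ℕ) :
    z m₀ ∈ integralH1 (FramedGaloisRep.toGaloisRep ρ) p (κ.layerSubgroup m₀) := by
  classical
  have hp : p.Prime := Fact.out
  rw [mem_integralH1_iff]
  intro v hv 𝔓 h𝔓
  have hvp : (p : 𝓞 ℚ) ∉ v.asIdeal := WeierstrassCurve.natCast_not_mem_asIdeal_of_primesEquiv_ne hp hv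
  -- the inertia groups above `v` lie in every layer
  have hIle : ∀ 𝔓' ∈ v.primesAbove, ∀ m : ℕ,
      𝔓'.inertia (absoluteGaloisGroup ℚ) ≤ κ.layerSubgroup m := fun 𝔓' h𝔓' m =>
    (ZpExtension.inertia_le_kerSubgroup_holds ℚ p κ hvp h𝔓').trans (κ.kerSubgroup_le_layerSubgroup m)
  -- generator data above the layer `n₀`
  obtain ⟨n₀, hn₀⟩ := exists_generator κ hκ hvp h𝔓
  obtain ⟨d, hd⟩ : ∃ d : ℕ, n₀ ≤ m₀ + d + 1 := ⟨n₀, by omega⟩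
  -- Step A: `z_{n'}` is unramified at every prime over `v`, `n' = m₀ + d + 1`
  have hA : ∀ 𝔓' ∈ v.primesAbove, resLe (FramedGaloisRep.toGaloisRep ρ).toTopRep
      (inf_le_left : κ.layerSubgroup (m₀ + d + 1) ⊓ 𝔓'.inertia (absoluteGaloisGroup ℚ) ≤ _) 1
      (z (m₀ + d + 1)) = 0 := by
    intro 𝔓' h𝔓'
    refine eq_zero_of_forall_exists_pow_smul_eq_of_compactSpace (FramedGaloisRep.toGaloisRep ρ) p
      (tendsto_pow_smul_pi_padicCoeffIntegers S) _ _ fun m => ?_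
    obtain ⟨S₀, hS₀⟩ := exists_finset_forall_sub_eq_pow_smul_framed S ρ hvp h𝔓' (hIle 𝔓' h𝔓' (m₀ + d + 1)) m
    set K := S₀.card * p ^ m with hK
    have hcard : S₀.card * p ^ m ≤ p ^ (K + 1) :=
      ((Nat.lt_pow_self hp.one_lt).le).trans (Nat.pow_le_pow_right hp.pos (Nat.le_succ K))
    obtain ⟨φ, hφ𝔓, hφU, hgen⟩ := hn₀ 𝔓' h𝔓' (m₀ + d + 1) hd (K + 1)
    haveI := finiteIndex_layerSubgroup p κ (m₀ + d + 1 + K + 1)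
    letI : Fintype (κ.layerSubgroup (m₀ + d + 1) ⧸
        (κ.layerSubgroup (m₀ + d + 1 + K + 1)).subgroupOf (κ.layerSubgroup (m₀ + d + 1))) :=
      Fintype.ofFinite _
    have hle : κ.layerSubgroup (m₀ + d + 1 + K + 1) ≤ κ.layerSubgroup (m₀ + d + 1) :=
      κ.layerSubgroup_antitone (Nat.le_add_right (m₀ + d + 1) (K + 1))
    have hPk : Fintype.card (κ.layerSubgroup (m₀ + d + 1) ⧸
        (κ.layerSubgroup (m₀ + d + 1 + K + 1)).subgroupOf (κ.layerSubgroup (m₀ + d + 1))) =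
        p ^ (K + 1) := by
      rw [Fintype.card_eq_nat_card]
      have h1 := Subgroup.relIndex_mul_index hle
      rw [index_layerSubgroup, index_layerSubgroup] at h1
      have h2 : (κ.layerSubgroup (m₀ + d + 1 + K + 1)).relIndex (κ.layerSubgroup (m₀ + d + 1)) *
          p ^ (m₀ + d + 1) = p ^ (K + 1) * p ^ (m₀ + d + 1) := by
        rw [h1, ← pow_add]
        congr 1
        omega
      exact Nat.eq_of_mul_eq_mul_right (pow_pos hp.pos _) h2
    have hgen' : ∀ u ∈ κ.layerSubgroup (m₀ + d + 1), ∃ i : ℕ,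
        (φ ^ i)⁻¹ * u ∈ κ.layerSubgroup (m₀ + d + 1 + K + 1) := by
      intro u hu
      obtain ⟨i, hi⟩ := hgen u hu
      exact ⟨i, by rw [add_assoc (m₀ + d + 1)]; exact hi⟩
    obtain ⟨y, hy⟩ := exists_resLe_coresLe_eq_pow_smul_of_generator_coeff (FramedGaloisRep.toGaloisRep ρ) p hle
      (κ.isOpen_layerSubgroup _) hPk (hIle 𝔓' h𝔓' _) hφU hφ𝔓 hgen' S₀ hS₀ hcard (z (m₀ + d + 1 + K + 1))
    refine ⟨y, ?_⟩
    rw [eq_coresLe_add_succ_coeff (FramedGaloisRep.toGaloisRep ρ) κ z hz (m₀ + d + 1) K, hy]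
  -- Step B: transport along `cor_{Γ_{n'} → Γ_{m₀}}` at class level
  haveI := finiteIndex_layerSubgroup p κ (m₀ + d + 1)
  letI : Fintype (κ.layerSubgroup m₀ ⧸ (κ.layerSubgroup (m₀ + d + 1)).subgroupOf (κ.layerSubgroup m₀)) :=
    Fintype.ofFinite _
  rw [eq_coresLe_add_succ_coeff (FramedGaloisRep.toGaloisRep ρ) κ z hz m₀ d]
  exact resLe_coresLe_eq_zero_of_forall_primesAbove (FramedGaloisRep.toGaloisRep ρ)
    (κ.layerSubgroup_antitone (Nat.le_add_right m₀ (d + 1))) (κ.isOpen_layerSubgroup (m₀ + d + 1))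
    (fun 𝔓' h𝔓' g _ hgI => hIle 𝔓' h𝔓' _ hgI) hA h𝔓

/-- **Kato 2004, Lemma 8.5 (2), for `T_ρ` with `𝒪` the valuation ring of a FINITE extension `ℚ_p(S)`
of `ℚ_p`** (`[FiniteDimensional ℚ_[p] (padicCoeffField S)]`, the standing hypothesis of the newform
lattices of the tree): cores-compatible families along the cyclotomic `ℤ_p`-tower are integral
(`mem_integralH1_of_layerCores_eq_framed` + `compactSpace_padicCoeffIntegers`).
[cite: Kato2004Asterisque, Lemma 8.5 (2) (p. 183)] [cite: Rubin2000, App. B Prop. B.3.3] -/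
theorem mem_integralH1_of_layerCores_eq_framed_of_finiteDimensional
    [FiniteDimensional ℚ_[p] (padicCoeffField S)]
    (κ : ZpExtension ℚ p) (hκ : κ.IsCyclotomic)
    (z : ∀ m : ℕ, H1 (FramedGaloisRep.toGaloisRep ρ) (κ.layerSubgroup m))
    (hz : ∀ m, layerCores (FramedGaloisRep.toGaloisRep ρ) κ m (z (m + 1)) = z m) (m₀ : ℕ) :
    z m₀ ∈ integralH1 (FramedGaloisRep.toGaloisRep ρ) p (κ.layerSubgroup m₀) := by
  haveI := compactSpace_padicCoeffIntegers S
  exact mem_integralH1_of_layerCores_eq_framed S ρ κ hκ z hz m₀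

end Assembly

end Literature.NumberTheory.EllipticCurves.Kato2004.UniversalNorms

end
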